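import Summits.QuantumFields.BalabanUV.Beta.GAN24.EffectiveFormInsertionLaw
import Literature.MathematicalPhysics.QuantumFieldTheory.Balaban1983to89.B5DeltaA169
import Literature.MathematicalPhysics.QuantumFieldTheory.Balaban1983to89.B5Lagrange149Torus

/-!
# `BalabanUV.Beta.GAN24.EffectiveFormKernel` — binder row G-an2-4 ∕ (CONV-C), routes C-R6° («VALUES») × R7 («TWO CURRENCIES»), PART 175:
# THE KERNEL OF THE LINEAGE's EFFECTIVE FORM `Σ_k = unitCovB_k⁻¹ − a·1` — `ker Σ_k = Q_k(ker(Δ − ∂P∂*))` EXACTLY, and it contains EVERY unit-lattice pure gauge `∂₁λ′`: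
# the (1.65)-dictionary effective form is exactly gauge invariant at every level `k`; hence NO kernel coercivity on `ker Q̃` without a gauge fixing (census V198 (d))
# (unit b2b-balaban-gan24-p3, gen 59; v1)

NOT IN PRINT; OUR PROOF ([folklore] finite-dimensional linear algebra + pv's B5 torus calculus BY NAME: `B5Hk160Torus.Lap_GradOp_mulVec` («Δ∂ = ∂Δ»), `B5Hk160Torus.QvOp_GradOp_mulVec`
(= [Balaban1984PropagatorsI] (1.55) p. 27 «Q_k∂ = ∂₁Q′_k»), `B5Action121.GradOp_conjTranspose_mul_GradOp` (`∂*∂ = Δ`), `B5LaplaceInverse.LapS_LapSinv_of_orth` ∕ `sum_LapSinv` (p. 22 «Δ⁻¹ on the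
complement of constants»), `B5Value126.PcT_mulVec` ∕ `sum_Minv_of_orth`, `B5Substitution125.Mop_mulVec` ∕ `Minv_Mop_of_orth` ∕ `Mop_Minv_of_orth` ∕ `Cavg_mulVec` ∕ `sum_Cavg_mulVec`,
`B5Lagrange149Torus.GradOp_const`, `B5DeltaA169.DeltaA` ∕ `calG_eq_DeltaA_inv` ∕ `isUnit_DeltaA` ((1.69)–(1.73) pp. 29–30), the NE2 lineage's `BalabanAveragedTowerUnit.unitCovB` ∕
`BalabanAveragedCoerciveTower.Atow_QBlev_eq_submatrix` («the composite of the one-step averagings is (1.18)») and PART 118 `EffectiveFormInsertionLaw.isUnit_det_unitCovB_and_opNorm_inv_le`.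
[Balaban1984PropagatorsI] p. 20 («δ(B − Q_kA) is invariant with respect to gauge transformations λ satisfying Q′_kλ = 0») and (1.24)–(1.26) p. 22 LOCATE the mechanism; [Balaban1984PropagatorsII]
(2.121) p. 244, (2.152)–(2.157) pp. 249–250 LOCATE the axial gauge fixing of the unit-lattice field that the consequence below calls for.  Nothing printed is a hypothesis.)
HONEST FRAMING (cell contract, verbatim): «discharging `BetaPertH` makes Bałaban's UV stability UNCONDITIONAL — a real constructive-QFT result; it is NOT the continuum limit
and NOT the Clay problem.»  HONEST DEPENDENCY (verbatim): «continuum YM on T⁴ ⇐ BetaPertH ∧ nine spine estimates (0/9 proved); BetaPertH ⇐ (D1) ∧ (D4) ∧ CAP+tail; G-an2-4 gates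
asym, D1 and NE2/3/4.»

WHY (census V198 (d), gen 58: «the ONE genuinely new input — a k-uniform KERNEL coercivity `QB·v = 0 ⟹ γ₀·nsq v ≤ re⟨v, Σ v⟩` … whether the first-order model's `Σ_k ≥ γ·(gradient form)` holds
is OPEN»).  THIS FILE settles the algebraic half: the lineage's `Σ_k = (unitCovB L M a ha k)⁻¹ − a•1` (PARTs 115–174) is, with `Q := Atow QBlev k` (= (1.18), `Atow_QBlev_eq_submatrix`),
`Q⋆ := n^d•Qᴴ` (`n = L^k`), `D := DeltaA − a•(QvAdj·QvOp) = Δ − ∂·PcT·∂ᴴ` ((1.69)/(1.70)): `Σ_k = (Q·(D + a•Q⋆Q)⁻¹·Q⋆)⁻¹ − a`, and for such a form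
**`Σ_k B = 0 ⟺ B = Q A₀ with D A₀ = 0`** (§1, §3): `Σ_k` is the HARD-CONSTRAINT effective form of `D`, the `a`-term being subtracted back.  `ker D` contains, besides the constants,
the fine pure gauges `∂λ`, `λ = Δ⁻²Q′ᴴν` (`ν ⊥ 1`), left free by the (1.26) gauge fixing of `N(Q′_k)` (§2), and `Q(∂λ) = ∂₁(Q′λ) = ∂₁(Mop ν)` reaches EVERY unit-lattice pure gauge (§3):
**`Σ_k (∂₁λ′) = 0` for all `λ′`** — the effective form is exactly gauge invariant, at every `k`, every `a > 0`, every torus.  CONSEQUENCE (§4, generic): a form with a nonzero null vector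
inside `ker Q̃` admits NO `γ₀ > 0` in PART 173's letter `hkerC`; and the next Bałaban averaging `Q̃` kills `∂₁λ′` whenever `Q̃′λ′ = 0` ((1.55) one level up) — so V198 (d) as located
is false for `Σ_k` WITHOUT a gauge fixing of the unit-lattice field; Bałaban's (2.152)–(2.157) integrate with `δ_{Ax}(B)` (axial gauge (2.121)) and use (2.153) on `ker Q̃ ∩ {B axial}`.
The numerics and the repair are in `HOME/b2b-balaban-gan24-p3/gen59/V198d-KERNEL.md` (kit job j286692: nullity of `Σ_k` on `ker Q̃` = #sites − #blocks exactly; smallest non-zero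
eigenvalue there ≈ 2.7, k-uniform).

WHAT THIS FILE PROVES (0 sorry, 0 `def`):
* §1 (generic, any finite index types, `ℂ`): **`inv_sub_mulVec_apply_eq_zero`** (`D A₀ = 0 ⟹ ((Q(D + a•Q⋆Q)⁻¹Q⋆)⁻¹ − a•1)(Q A₀) = 0`) and **`exists_ker_of_inv_sub_mulVec_eq_zero`** (the converse:
  a null vector `B` is `Q A₀` with `D A₀ = 0`, `A₀ = a·(D + a•Q⋆Q)⁻¹Q⋆B`), under `IsUnit (D + a•Q⋆Q)` and `IsUnit (Q(D + a•Q⋆Q)⁻¹Q⋆)`.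
* §2 (B5's torus operators, `n ≥ 1`, any `a`): **`deltaA_sub_mulVec_grad_eq_zero`** — `(DeltaA − a•(QvAdj·QvOp))·∂λ = 0` for `λ = Δ⁻¹Δ⁻¹Q′ᴴν`, `Σν = 0`; `QvOp_mulVec_grad` — `Q(∂λ) = ∂₁(Mop ν)`.
* §3 (the lineage's tower, `L ≥ 1`, `a > 0`, every `k`): `smul_conjTranspose_Atow_mul_Atow` (`(n^d•Qᴴ)Q = QvAdj·QvOp`), `unitCovB_eq_sandwich` (`unitCovB_k = Q·(D + a•Q⋆Q)⁻¹·Q⋆`),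
  **`effForm_mulVec_eq_zero_iff`** (`ker Σ_k = Q_k(ker D_k)`), `Atow_mulVec_apply` and **`effForm_mulVec_unitGrad`** (`Σ_k·(∂₁λ′ ∘ unitIdx) = 0` for EVERY `λ′ : Tor M → ℂ`).
* §4 (generic): **`gamma_nonpos_of_null_vector`** — if `H v₀ = 0`, `Q̃ v₀ = 0`, `v₀ ≠ 0` and `∀ v, Q̃v = 0 → γ₀·nsq v ≤ re⟨v, Hv⟩`, then `γ₀ ≤ 0` (the shape of PART 173's `hkerC`).
WHAT IT IS NOT: the NEXT averaging `Q̃` of census V197 is not fixed here (either option changes only the index bookkeeping of `∂₁λ′ ∈ ker Q̃`, (1.55)); nothing of Bałaban's (2.153) is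
claimed; the positive statement (coercivity on `ker Q̃ ∩ {axial}`) is pv09's `B6Constraint2153QvOp` vocabulary and is NOT typed here.  SUPPLIER work; NEVER «G-an2-4 closed»; NOT (CONV-C),
NOT D1, NOT `BetaPertH`, NOT continuum, NOT Clay.  Records: `HOME/b2b-balaban-gan24-p3/gen59/README.md`.
-/

noncomputable section

open scoped BigOperators ComplexConjugate Matrix
open Finset Matrix

namespace Summit.QuantumFields.BalabanUV.Beta.GAN24.EffectiveFormKernel

open Literature.MathematicalPhysics.QuantumFieldTheory.Balaban1983to89
open Literature.MathematicalPhysics.QuantumFieldTheory.Balaban1983to89.B5Prop11Plancherel (Tor fine)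
open Literature.MathematicalPhysics.QuantumFieldTheory.Balaban1983to89.B5Prop11Lower (nsq nsq_nonneg Lap)
open Literature.MathematicalPhysics.QuantumFieldTheory.Balaban1983to89.B5Action121 (GradOp LapS GradOp_conjTranspose_mul_GradOp)
open Literature.MathematicalPhysics.QuantumFieldTheory.Balaban1983to89.B5LaplaceInverse (LapSinv LapS_LapSinv_of_orth sum_LapSinv)
open Literature.MathematicalPhysics.QuantumFieldTheory.Balaban1983to89.B5Block118 (QsOp QvOp)
open Literature.MathematicalPhysics.QuantumFieldTheory.Balaban1983to89.B5Substitution125 (Mop Minv Cavg Mop_mulVec Minv_Mop_of_orth Mop_Minv_of_orth Cavg_mulVec sum_Cavg_mulVec)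
open Literature.MathematicalPhysics.QuantumFieldTheory.Balaban1983to89.B5Value126 (PcT PcT_mulVec sum_Minv_of_orth)
open Literature.MathematicalPhysics.QuantumFieldTheory.Balaban1983to89.B5DeltaA169 (QvAdj DeltaA calG_eq_DeltaA_inv isUnit_DeltaA)
open Literature.MathematicalPhysics.QuantumFieldTheory.Balaban1983to89.B5Hk160Torus (Lap_GradOp_mulVec QvOp_GradOp_mulVec)
open Literature.MathematicalPhysics.QuantumFieldTheory.Balaban1983to89.B5Lagrange149Torus (GradOp_const)
open Literature.MathematicalPhysics.QuantumFieldTheory.Balaban1983to89.B5G183RateUnitTower (lev)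
open Summit.QuantumFields.BalabanUV.T4Continuum.CovariantAveragingTower (Atow avgTow)
open Summit.QuantumFields.BalabanUV.T4Continuum.BalabanAveragedTowerUnit (idx QBlev calGlev unitCovB one_le_lev' cast_lev')
open Summit.QuantumFields.BalabanUV.T4Continuum.BalabanAveragedCoerciveTower (unitIdx Atow_QBlev_eq_submatrix)
open Summit.QuantumFields.BalabanUV.Beta.GAN24.EffectiveFormInsertionLaw (isUnit_det_unitCovB_and_opNorm_inv_le)

/-! ## §1 Generic: the kernel of `(Q(D + a•Q⋆Q)⁻¹Q⋆)⁻¹ − a` is `Q(ker D)` -/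

section Generic

variable {m ν : Type*} [Fintype m] [Fintype ν] [DecidableEq m] [DecidableEq ν]

/-- **`inv_sub_mulVec_apply_eq_zero` — NULL VECTORS OF THE HARD-CONSTRAINT EFFECTIVE FORM**: with `M = D + a•Q⋆Q` and `c = Q M⁻¹ Q⋆` invertible, every `A₀ ∈ ker D` gives
`(c⁻¹ − a)(Q A₀) = 0` — `M A₀ = aQ⋆(QA₀)`, so `QA₀ = a·c(QA₀)` and `c⁻¹(QA₀) = a(QA₀)`. [folklore] -/
theorem inv_sub_mulVec_apply_eq_zero (D : Matrix ν ν ℂ) (Q : Matrix m ν ℂ) (Qs : Matrix ν m ℂ) (a : ℂ)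
    (hM : IsUnit (D + a • (Qs * Q))) (hc : IsUnit (Q * (D + a • (Qs * Q))⁻¹ * Qs))
    {A₀ : ν → ℂ} (hA₀ : D *ᵥ A₀ = 0) :
    ((Q * (D + a • (Qs * Q))⁻¹ * Qs)⁻¹ - a • (1 : Matrix m m ℂ)) *ᵥ (Q *ᵥ A₀) = 0 := by
  set Mx : Matrix ν ν ℂ := D + a • (Qs * Q) with hMx
  set c : Matrix m m ℂ := Q * Mx⁻¹ * Qs with hc'
  have hdetM := (Matrix.isUnit_iff_isUnit_det _).mp hM
  have hdetc := (Matrix.isUnit_iff_isUnit_det _).mp hc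
  have h1 : Mx *ᵥ A₀ = a • (Qs *ᵥ (Q *ᵥ A₀)) := by
    rw [hMx, Matrix.add_mulVec, hA₀, zero_add, Matrix.smul_mulVec, ← Matrix.mulVec_mulVec]
  have h2 : A₀ = a • (Mx⁻¹ *ᵥ (Qs *ᵥ (Q *ᵥ A₀))) := by
    have h := congrArg (fun w => Mx⁻¹ *ᵥ w) h1
    rwa [Matrix.mulVec_mulVec, Matrix.nonsing_inv_mul _ hdetM, Matrix.one_mulVec, Matrix.mulVec_smul] at h
  have h3 : Q *ᵥ A₀ = a • (c *ᵥ (Q *ᵥ A₀)) := by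
    conv_lhs => rw [h2]
    rw [Matrix.mulVec_smul, hc', ← Matrix.mulVec_mulVec, ← Matrix.mulVec_mulVec]
  rw [Matrix.sub_mulVec, Matrix.smul_mulVec, Matrix.one_mulVec, sub_eq_zero]
  conv_lhs => rw [h3]
  rw [Matrix.mulVec_smul, Matrix.mulVec_mulVec, Matrix.nonsing_inv_mul _ hdetc, Matrix.one_mulVec]

/-- **`exists_ker_of_inv_sub_mulVec_eq_zero` — THE CONVERSE**: every null vector `B` of `(Q M⁻¹Q⋆)⁻¹ − a` is the average `Q A₀` of `A₀ := a·M⁻¹Q⋆B ∈ ker D`.  Together: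
`ker((Q(D + a•Q⋆Q)⁻¹Q⋆)⁻¹ − a) = Q(ker D)`. [folklore] -/
theorem exists_ker_of_inv_sub_mulVec_eq_zero (D : Matrix ν ν ℂ) (Q : Matrix m ν ℂ) (Qs : Matrix ν m ℂ) (a : ℂ)
    (hM : IsUnit (D + a • (Qs * Q))) (hc : IsUnit (Q * (D + a • (Qs * Q))⁻¹ * Qs))
    {B : m → ℂ} (hB : ((Q * (D + a • (Qs * Q))⁻¹ * Qs)⁻¹ - a • (1 : Matrix m m ℂ)) *ᵥ B = 0) :
    ∃ A₀ : ν → ℂ, D *ᵥ A₀ = 0 ∧ Q *ᵥ A₀ = B := by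
  set Mx : Matrix ν ν ℂ := D + a • (Qs * Q) with hMx
  set c : Matrix m m ℂ := Q * Mx⁻¹ * Qs with hc'
  have hdetM := (Matrix.isUnit_iff_isUnit_det _).mp hM
  have hdetc := (Matrix.isUnit_iff_isUnit_det _).mp hc
  have h1 : c⁻¹ *ᵥ B = a • B := by
    rw [Matrix.sub_mulVec, Matrix.smul_mulVec, Matrix.one_mulVec, sub_eq_zero] at hB
    exact hB
  have h2 : a • (c *ᵥ B) = B := by
    have h := congrArg (fun w => c *ᵥ w) h1
    rw [Matrix.mulVec_mulVec, Matrix.mul_nonsing_inv _ hdetc, Matrix.one_mulVec, Matrix.mulVec_smul] at h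
    exact h.symm
  have hQA : Q *ᵥ (a • (Mx⁻¹ *ᵥ (Qs *ᵥ B))) = B := by
    rw [Matrix.mulVec_smul, Matrix.mulVec_mulVec, Matrix.mulVec_mulVec, ← hc', h2]
  have hD : D = Mx - a • (Qs * Q) := by rw [hMx, add_sub_cancel_right]
  refine ⟨a • (Mx⁻¹ *ᵥ (Qs *ᵥ B)), ?_, hQA⟩
  have e1 : (Qs * Q) *ᵥ (a • (Mx⁻¹ *ᵥ (Qs *ᵥ B))) = Qs *ᵥ B := by rw [← Matrix.mulVec_mulVec, hQA]
  have e2 : Mx *ᵥ (a • (Mx⁻¹ *ᵥ (Qs *ᵥ B))) = a • (Qs *ᵥ B) := by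
    rw [Matrix.mulVec_smul, Matrix.mulVec_mulVec, Matrix.mul_nonsing_inv _ hdetM, Matrix.one_mulVec]
  rw [hD, Matrix.sub_mulVec, Matrix.smul_mulVec, e1, e2, sub_self]

end Generic

/-! ## §2 B5's torus: the fine pure gauges compatible with the (1.26) gauge fixing are in `ker(Δ − ∂P∂*)` -/

section Model

variable {d : ℕ} (n : ℕ) [NeZero n] (M : Fin d → ℕ) [hM : ∀ μ, NeZero (M μ)] (a : ℝ)

/-- **`deltaA_sub_mulVec_grad_eq_zero` — THE GAUGE MODES OF `D = Δ_a − aQ*Q = Δ − ∂P∂*`**: for every unit-lattice scalar `ν ⊥ 1`, the fine pure gauge `∂λ` with `λ = Δ⁻¹Δ⁻¹Q′ᴴν`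
satisfies `D(∂λ) = 0`: `Δ∂λ = ∂Δλ = ∂w` with `w = Δ⁻¹Q′ᴴν` («Δ∂ = ∂Δ», `Δ⁻¹` on `1^⊥`), `∂ᴴ∂λ = Δλ = w`, and `Pw = Δ⁻¹Q′ᴴ(Q′Δ⁻²Q′ᴴ)⁻¹(Q′Δ⁻²Q′ᴴ)ν = w` — these are exactly the
gauge functions of `N(Q′_k)^⊥` that (1.24)–(1.26) do NOT fix. [folklore] -/
theorem deltaA_sub_mulVec_grad_eq_zero (ν : Tor M → ℂ) (hν : ∑ y, ν y = 0) :
    (DeltaA n M a - (a : ℂ) • (QvAdj n M * QvOp n M)) *ᵥ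
      (GradOp (fine n M) (n : ℂ) *ᵥ (LapSinv (fine n M) (n : ℂ) *ᵥ (LapSinv (fine n M) (n : ℂ) *ᵥ ((QsOp n M)ᴴ *ᵥ ν)))) = 0 := by
  have hnc : (n : ℂ) ≠ 0 := by exact_mod_cast NeZero.ne n
  set w : Tor (fine n M) → ℂ := LapSinv (fine n M) (n : ℂ) *ᵥ ((QsOp n M)ᴴ *ᵥ ν) with hw
  set lam : Tor (fine n M) → ℂ := LapSinv (fine n M) (n : ℂ) *ᵥ w with hlam
  have hw0 : ∑ x, w x = 0 := sum_LapSinv (fine n M) (n : ℂ) _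
  have hD : DeltaA n M a - (a : ℂ) • (QvAdj n M * QvOp n M)
      = Lap n M - GradOp (fine n M) (n : ℂ) * PcT n M (n : ℂ) * (GradOp (fine n M) (n : ℂ))ᴴ := by
    rw [DeltaA, add_sub_cancel_right]
  have h2 : LapS (fine n M) (n : ℂ) *ᵥ lam = w := by rw [hlam]; exact LapS_LapSinv_of_orth (fine n M) hnc w hw0
  have h3 : (GradOp (fine n M) (n : ℂ))ᴴ *ᵥ (GradOp (fine n M) (n : ℂ) *ᵥ lam) = w := by
    rw [Matrix.mulVec_mulVec, GradOp_conjTranspose_mul_GradOp, h2]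
  have h4 : PcT n M (n : ℂ) *ᵥ w = w := by
    rw [PcT_mulVec]
    have e : QsOp n M *ᵥ (LapSinv (fine n M) (n : ℂ) *ᵥ w) = Mop n M (n : ℂ) *ᵥ ν := by rw [Mop_mulVec, hw]
    rw [e, Minv_Mop_of_orth n M (n : ℂ) hnc ν hν, hw]
  rw [hD, Matrix.sub_mulVec, Lap_GradOp_mulVec, h2, ← Matrix.mulVec_mulVec, ← Matrix.mulVec_mulVec, h3, h4, sub_self]

omit [NeZero n] hM in
/-- **(1.55) on these modes**: `Q(∂λ) = ∂₁(Q′λ) = ∂₁(Q′Δ⁻²Q′ᴴν) = ∂₁(Mop ν)` — the average of the compatible fine pure gauge is the unit-lattice pure gauge of `Mop ν`.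
[cite: Balaban1984PropagatorsI, (1.55) p.27] [folklore] -/
theorem QvOp_mulVec_grad [NeZero n] [∀ μ, NeZero (M μ)] (ν : Tor M → ℂ) :
    QvOp n M *ᵥ (GradOp (fine n M) (n : ℂ) *ᵥ (LapSinv (fine n M) (n : ℂ) *ᵥ (LapSinv (fine n M) (n : ℂ) *ᵥ ((QsOp n M)ᴴ *ᵥ ν))))
      = GradOp M 1 *ᵥ (Mop n M (n : ℂ) *ᵥ ν) := by
  rw [QvOp_GradOp_mulVec, Mop_mulVec]

end Model

/-! ## §3 The lineage's tower: `ker Σ_k = Q_k(ker D_k)` and `Σ_k(∂₁λ′) = 0` for every `λ′` -/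

section Tower

variable {d : ℕ} (L : ℕ) [NeZero L] (M : Fin d → ℕ) [hM : ∀ μ, NeZero (M μ)] (a : ℝ) (ha : 0 < a)

omit hM in
/-- `(n^d•Qᴴ)·Q = Q*_kQ_k` for `Q = Atow QBlev k` = (1.18) reindexed by `unitIdx` (`QvAdj = n^d•QvOpᴴ`). [folklore] -/
theorem smul_conjTranspose_Atow_mul_Atow [∀ μ, NeZero (M μ)] (k : ℕ) :
    ((((lev L k : ℕ) : ℂ) ^ d) • (Atow (QBlev L M) k)ᴴ) * Atow (QBlev L M) k = QvAdj (lev L k) M * QvOp (lev L k) M := by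
  rw [Atow_QBlev_eq_submatrix, Matrix.smul_mul, Matrix.conjTranspose_submatrix, Matrix.submatrix_mul_equiv, Matrix.submatrix_id_id, QvAdj,
    Matrix.smul_mul]

/-- **`unitCovB_eq_sandwich`**: `unitCovB_k = Q·Δ_a⁻¹·Q⋆` with `Q = Atow QBlev k`, `Q⋆ = n^d•Qᴴ`, `Δ_a = DeltaA (lev L k) M a` (`(L^d)^k = n^d`, `calGlev = Δ_a⁻¹`). [folklore] -/
theorem unitCovB_eq_sandwich (k : ℕ) :
    unitCovB L M a ha k = Atow (QBlev L M) k * (DeltaA (lev L k) M a)⁻¹ * ((((lev L k : ℕ) : ℂ) ^ d) • (Atow (QBlev L M) k)ᴴ) := by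
  have hr : ((((L : ℝ) ^ d : ℝ)) : ℂ) ^ k = (((lev L k : ℕ) : ℂ)) ^ d := by
    have h1 : (((lev L k : ℕ) : ℂ)) = (((lev L k : ℕ) : ℝ) : ℂ) := by norm_cast
    rw [h1, cast_lev']
    push_cast
    rw [← pow_mul, ← pow_mul, mul_comm]
  rw [unitCovB, avgTow, hr, Matrix.mul_smul]
  congr 2
  rw [calGlev, calG_eq_DeltaA_inv]

/-- `D_k + a•Q⋆Q = Δ_a` at level `k`. [folklore] -/
theorem deltaA_sub_add (k : ℕ) :
    (DeltaA (lev L k) M a - (a : ℂ) • (QvAdj (lev L k) M * QvOp (lev L k) M))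
      + (a : ℂ) • (((((lev L k : ℕ) : ℂ) ^ d) • (Atow (QBlev L M) k)ᴴ) * Atow (QBlev L M) k) = DeltaA (lev L k) M a := by
  rw [smul_conjTranspose_Atow_mul_Atow, sub_add_cancel]

/-- **`effForm_mulVec_eq_zero_iff` — THE KERNEL OF THE EFFECTIVE FORM ALONG THE TOWER**: for every level `k` and every unit-lattice field `B`,
`((unitCovB_k)⁻¹ − a•1)·B = 0 ⟺ B = (Atow QBlev k)·A₀` for some `A₀` with `(Δ_a − aQ*Q)·A₀ = 0` — `Σ_k` is the hard-constraint effective form of `D_k = Δ − ∂P∂*` at level `k`,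
and its kernel is exactly the image of `ker D_k` under the `k`-fold averaging. [folklore] -/
theorem effForm_mulVec_eq_zero_iff (k : ℕ) (B : idx L M 0 → ℂ) :
    ((unitCovB L M a ha k)⁻¹ - (a : ℂ) • (1 : Matrix (idx L M 0) (idx L M 0) ℂ)) *ᵥ B = 0 ↔
      ∃ A₀ : idx L M k → ℂ, (DeltaA (lev L k) M a - (a : ℂ) • (QvAdj (lev L k) M * QvOp (lev L k) M)) *ᵥ A₀ = 0 ∧ Atow (QBlev L M) k *ᵥ A₀ = B := by
  have hDa := deltaA_sub_add L M a k
  have hM' : IsUnit ((DeltaA (lev L k) M a - (a : ℂ) • (QvAdj (lev L k) M * QvOp (lev L k) M))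
      + (a : ℂ) • (((((lev L k : ℕ) : ℂ) ^ d) • (Atow (QBlev L M) k)ᴴ) * Atow (QBlev L M) k)) := by
    rw [hDa]; exact isUnit_DeltaA (lev L k) (one_le_lev' L k) M a ha
  have hcov : unitCovB L M a ha k = Atow (QBlev L M) k
      * ((DeltaA (lev L k) M a - (a : ℂ) • (QvAdj (lev L k) M * QvOp (lev L k) M))
          + (a : ℂ) • (((((lev L k : ℕ) : ℂ) ^ d) • (Atow (QBlev L M) k)ᴴ) * Atow (QBlev L M) k))⁻¹
      * ((((lev L k : ℕ) : ℂ) ^ d) • (Atow (QBlev L M) k)ᴴ) := by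
    rw [hDa]; exact unitCovB_eq_sandwich L M a ha k
  have hc' : IsUnit (Atow (QBlev L M) k
      * ((DeltaA (lev L k) M a - (a : ℂ) • (QvAdj (lev L k) M * QvOp (lev L k) M))
          + (a : ℂ) • (((((lev L k : ℕ) : ℂ) ^ d) • (Atow (QBlev L M) k)ᴴ) * Atow (QBlev L M) k))⁻¹
      * ((((lev L k : ℕ) : ℂ) ^ d) • (Atow (QBlev L M) k)ᴴ)) := by
    rw [← hcov]; exact (Matrix.isUnit_iff_isUnit_det _).mpr (isUnit_det_unitCovB_and_opNorm_inv_le L M a ha k).1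
  rw [hcov]
  constructor
  · intro hB
    exact exists_ker_of_inv_sub_mulVec_eq_zero _ _ _ _ hM' hc' hB
  · rintro ⟨A₀, hA₀, rfl⟩
    exact inv_sub_mulVec_apply_eq_zero _ _ _ _ hM' hc' hA₀

omit hM in
/-- rows of `(Atow QBlev k)·A` are the rows of `Q_k·A` at the relabelled unit bond. [folklore] -/
theorem Atow_mulVec_apply [∀ μ, NeZero (M μ)] (k : ℕ) (A : idx L M k → ℂ) (i : idx L M 0) :
    (Atow (QBlev L M) k *ᵥ A) i = (QvOp (lev L k) M *ᵥ A) (unitIdx L M i) := by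
  rw [Atow_QBlev_eq_submatrix]
  rfl

/-- **`effForm_mulVec_unitGrad` — THE EFFECTIVE FORM IS EXACTLY GAUGE INVARIANT**: for EVERY unit-lattice scalar `λ′ : Tor M → ℂ` and every level `k`,
`((unitCovB_k)⁻¹ − a•1)·(∂₁λ′) = 0` (the unit-lattice pure gauge `∂₁λ′ = GradOp M 1 λ′`, read on `idx L M 0` through `unitIdx`).  With §4: no `γ₀ > 0` can satisfy PART 173's `hkerC` for
`Σ_k` and any constraint `Q̃` that kills one nonzero `∂₁λ′` — e.g. the next Bałaban averaging, which kills `∂₁λ′` whenever `Q̃′λ′ = 0` ((1.55) one level up). [folklore] -/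
theorem effForm_mulVec_unitGrad (k : ℕ) (lam' : Tor M → ℂ) :
    ((unitCovB L M a ha k)⁻¹ - (a : ℂ) • (1 : Matrix (idx L M 0) (idx L M 0) ℂ)) *ᵥ (fun i => (GradOp M 1 *ᵥ lam') (unitIdx L M i)) = 0 := by
  have hnc : ((lev L k : ℕ) : ℂ) ≠ 0 := by exact_mod_cast NeZero.ne (lev L k)
  -- split off the mean: `λ′ = λ₀ + const`, `λ₀ ⊥ 1`, `∂₁ const = 0`
  set lam0 : Tor M → ℂ := lam' - Cavg M *ᵥ lam' with hlam0
  have hsum : ∑ y, lam0 y = 0 := by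
    simp only [hlam0, Pi.sub_apply, Finset.sum_sub_distrib, sum_Cavg_mulVec, sub_self]
  have hgrad : GradOp M 1 *ᵥ lam' = GradOp M 1 *ᵥ lam0 := by
    have e : lam' = lam0 + Cavg M *ᵥ lam' := by rw [hlam0, sub_add_cancel]
    conv_lhs => rw [e]
    rw [Matrix.mulVec_add, Cavg_mulVec, GradOp_const, add_zero]
  -- the compatible fine pure gauge with `Q(∂λ) = ∂₁λ₀`: `ν = Minv λ₀`
  set ν : Tor M → ℂ := Minv (lev L k) M ((lev L k : ℕ) : ℂ) *ᵥ lam0 with hν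
  have hν0 : ∑ y, ν y = 0 := sum_Minv_of_orth (lev L k) M ((lev L k : ℕ) : ℂ) hnc lam0 hsum
  set A₀ : idx L M k → ℂ := GradOp (fine (lev L k) M) ((lev L k : ℕ) : ℂ) *ᵥ (LapSinv (fine (lev L k) M) ((lev L k : ℕ) : ℂ) *ᵥ
    (LapSinv (fine (lev L k) M) ((lev L k : ℕ) : ℂ) *ᵥ ((QsOp (lev L k) M)ᴴ *ᵥ ν))) with hA₀
  refine (effForm_mulVec_eq_zero_iff L M a ha k _).mpr ⟨A₀, deltaA_sub_mulVec_grad_eq_zero (lev L k) M a ν hν0, ?_⟩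
  funext i
  rw [Atow_mulVec_apply, hA₀, QvOp_mulVec_grad, hν, Mop_Minv_of_orth (lev L k) M ((lev L k : ℕ) : ℂ) hnc lam0 hsum, hgrad]

end Tower

/-! ## §4 Generic: a null vector inside `ker Q̃` forbids kernel coercivity -/

section Coercivity

variable {m c : Type*} [Fintype m]

/-- **`gamma_nonpos_of_null_vector`**: if `H v₀ = 0`, `Q̃ v₀ = 0`, `v₀ ≠ 0`, then every `γ₀` with `∀ v, Q̃v = 0 → γ₀·nsq v ≤ re⟨v, Hv⟩` (PART 173's letter `hkerC`) is `≤ 0`. [folklore] -/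
theorem gamma_nonpos_of_null_vector (H : Matrix m m ℂ) (Qt : Matrix c m ℂ) {v₀ : m → ℂ} (hv₀ : v₀ ≠ 0) (hH : H *ᵥ v₀ = 0) (hQ : Qt *ᵥ v₀ = 0)
    {γ₀ : ℝ} (hker : ∀ v : m → ℂ, Qt *ᵥ v = 0 → γ₀ * nsq v ≤ (star v ⬝ᵥ (H *ᵥ v)).re) : γ₀ ≤ 0 := by
  have h := hker v₀ hQ
  rw [hH, dotProduct_zero, Complex.zero_re] at h
  have hpos : 0 < nsq v₀ := by
    rcases (nsq_nonneg v₀).eq_or_lt with h0 | hlt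
    · exfalso
      apply hv₀
      funext i
      have hi := (Finset.sum_eq_zero_iff_of_nonneg fun i _ => sq_nonneg ‖v₀ i‖).mp h0.symm i (Finset.mem_univ i)
      exact norm_eq_zero.mp (pow_eq_zero_iff two_ne_zero |>.mp hi)
    · exact hlt
  nlinarith

end Coercivity

end Summit.QuantumFields.BalabanUV.Beta.GAN24.EffectiveFormKernel

end
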